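import Summits.Ventures.PercRepro.ProfilePointedColoop

/-!
# PercRepro — `RowAll` IS CLOSED UNDER ADDING A COLOOP: THE FIRST OPEN INSTANCE OF `HardRowQ''` NEEDS ONLY
COLOOP-FREE MATROIDS (p10, gen 22; `proofs/P10-COLOOPEXT-g22.md` §3)

`RowAll` (ProfileRowAll) is the all-levels conjecture `(n − k)·(P_{k−1} + S_k) ≤ k·(P_{k+1} + S_{k+1})` for `1 ≤ k`,
`2k + 1 ≤ n = #E`, with `P_k = #biIndepSets M k` and `S_k = uniSymm M k = U_k + U_{n+1−k}`, `U_k = #uniIndepSets M k`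
(the unicyclic `k`-sets with independent complement) — the pointed conjecture (Ĉ) at the free coextension.  Let `e` be a
COLOOP of `M` (`ρ(E ∖ e) + 1 = ρ(E)`) and `M' = M ∖ e` on `n − 1` elements.  Beside gen 13's split
`P_k(M) = P_k(M') + P_{k−1}(M')` (`card_biIndepSets_coloop`), THIS FILE proves the same split for the unicyclic counts —
`U_k(M) = U_k(M') + U_{k−1}(M')` (`card_uniIndepSets_coloop`: a coloop raises the rank and the size of every set through
it by one, so nullity is unchanged, and it is independent on the complement side) — hence `S_k(M) = S_k(M') + S_{k−1}(M')`
(`uniSymm_coloop`), and then the `RowAll` instance of `M` at level `k` is the SUM of the instances of `M'` at levels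
`k − 1` and `k` plus `P_{k−1}(M') ≤ P_k(M')`, the unimodality of the bi-independent density of `M'` under the named fact
(`biIndepDensity_mono_of_fact`); at the boundary `2k + 1 = n` the level-`k` instance of `M'` lies outside its window and
the symmetries `P_{k+1}(M') = P_{k−1}(M')`, `S_{k+1}(M') = S_k(M')` on `2k` elements replace it
(`rowAll_of_delete_coloop_of_fact`; the level `k = 1` uses `S_0(M') = 0`).  Hence (`rowAllAt_of_delete_coloop_of_fact`):
`RowAll` at every level of `M ∖ e` gives `RowAll` at every level of `M` — CONDITIONAL on the named fact
`BiIndepDensityLogConcave` (Theorem A, Brändén–Huh); everything else here is unconditional.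

CONSEQUENCE: a `RowAll`-witness with a coloop has a `RowAll`-witness among its coloop-deletions, so `RowAll` — and with it
the first open instance of `HardRowQ''`, the top-but-one row at `#E = ρ + q + 1` for every `q ≥ 3`
(`profileIneqMinusQ_top_but_one_succ_of_rowAll`) — needs to be proved only on COLOOP-FREE matroids (p5's coloop dispatch
`HardRowIHBand` removed the coloops of that row by another route).  Nothing here asserts `RowAll`.
-/

open scoped Matroid

namespace PercRepro.Cogirth

open Finset ThmH Skew

variable {α : Type} [DecidableEq α] {M : Matroid α} [M.Finite]

/-! ### The unicyclic sets at a coloop -/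

/-- For a coloop `e`, the unicyclic `k`-sets (with independent complement) of `M` avoiding `e` are exactly those of
`M ∖ e`. -/
theorem filter_uniIndepSets_notMem_coloop {e : α} (he : e ∈ gr M)
    (hec : rk M ((gr M).erase e) + 1 = rk M (gr M)) (k : ℕ) :
    (uniIndepSets M k).filter (fun X => e ∉ X) = uniIndepSets (M ＼ ({e} : Set α)) k := by
  ext X
  rw [mem_filter, mem_uniIndepSets, mem_uniIndepSets, gr_delete']
  constructor
  · rintro ⟨⟨hXg, hXk, hXr, hXc⟩, heX⟩
    have hXg' : X ⊆ (gr M).erase e := fun x hx => mem_erase.2 ⟨fun h => heX (h ▸ hx), hXg hx⟩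
    have heZ : e ∈ gr M \ X := mem_sdiff.2 ⟨he, heX⟩
    refine ⟨hXg', hXk, by rw [rk_delete hXg']; exact hXr, ?_⟩
    rw [rk_delete sdiff_subset, erase_sdiff]
    have h := rk_insert_of_coloop' he hec (X := (gr M \ X).erase e)
      ((erase_subset _ _).trans sdiff_subset) (notMem_erase _ _)
    have hc := card_erase_add_one heZ
    rw [insert_erase heZ, hXc] at h
    omega
  · rintro ⟨hXg', hXk, hXr, hXc⟩
    have heX : e ∉ X := fun h => (mem_erase.1 (hXg' h)).1 rfl
    have hXg : X ⊆ gr M := fun x hx => (mem_erase.1 (hXg' hx)).2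
    have heZ : e ∈ gr M \ X := mem_sdiff.2 ⟨he, heX⟩
    rw [rk_delete hXg'] at hXr
    rw [rk_delete sdiff_subset, erase_sdiff] at hXc
    refine ⟨⟨hXg, hXk, hXr, ?_⟩, heX⟩
    have h := rk_insert_of_coloop' he hec (X := (gr M \ X).erase e)
      ((erase_subset _ _).trans sdiff_subset) (notMem_erase _ _)
    have hc := card_erase_add_one heZ
    rw [insert_erase heZ, hXc] at h
    omega

/-- For a coloop `e`, the unicyclic `k`-sets of `M` through `e` are the unicyclic `(k − 1)`-sets of `M ∖ e` plus `e`. -/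
theorem card_filter_uniIndepSets_mem_coloop {e : α} (he : e ∈ gr M)
    (hec : rk M ((gr M).erase e) + 1 = rk M (gr M)) {k : ℕ} (hk : 1 ≤ k) :
    ((uniIndepSets M k).filter (fun X => e ∈ X)).card = (uniIndepSets (M ＼ ({e} : Set α)) (k - 1)).card := by
  apply card_bij (fun X _ => X.erase e)
  · intro X hX
    rw [mem_filter, mem_uniIndepSets] at hX
    obtain ⟨⟨hXg, hXk, hXr, hXc⟩, heX⟩ := hX
    rw [mem_uniIndepSets, gr_delete']
    have hXg' : X.erase e ⊆ (gr M).erase e := erase_subset_erase e hXg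
    refine ⟨hXg', by rw [card_erase_of_mem heX, hXk], ?_, ?_⟩
    · rw [rk_delete hXg']
      have h := rk_insert_of_coloop' he hec ((erase_subset _ _).trans hXg) (notMem_erase e X)
      rw [insert_erase heX] at h
      rw [card_erase_of_mem heX]
      omega
    · rw [rk_delete sdiff_subset]
      have e' : (gr M).erase e \ X.erase e = gr M \ X := by
        ext x
        simp only [mem_sdiff, mem_erase]
        constructor
        · rintro ⟨⟨hxe, hx⟩, hxX⟩
          exact ⟨hx, fun h => hxX ⟨hxe, h⟩⟩
        · rintro ⟨hx, hxX⟩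
          exact ⟨⟨fun h => hxX (h ▸ heX), hx⟩, fun h => hxX h.2⟩
      rw [e']
      exact hXc
  · intro X hX Y hY h
    rw [mem_filter] at hX hY
    rw [← insert_erase hX.2, ← insert_erase hY.2, h]
  · intro Y hY
    rw [mem_uniIndepSets, gr_delete'] at hY
    obtain ⟨hYg', hYk, hYr, hYc⟩ := hY
    have heY : e ∉ Y := fun h => (mem_erase.1 (hYg' h)).1 rfl
    have hYg : Y ⊆ gr M := fun x hx => (mem_erase.1 (hYg' hx)).2
    refine ⟨insert e Y, ?_, erase_insert heY⟩
    rw [mem_filter, mem_uniIndepSets]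
    refine ⟨⟨insert_subset he hYg, by rw [card_insert_of_notMem heY, hYk]; omega, ?_, ?_⟩,
      mem_insert_self _ _⟩
    · rw [rk_insert_of_coloop' he hec hYg heY, card_insert_of_notMem heY, ← rk_delete hYg']
      omega
    · rw [rk_delete sdiff_subset] at hYc
      have e' : gr M \ insert e Y = (gr M).erase e \ Y := by
        ext x
        simp only [mem_sdiff, mem_insert, mem_erase, not_or]
        tauto
      rw [e']
      exact hYc

/-- **The unicyclic profile at a coloop**: `U_k(M) = U_k(M ∖ e) + U_{k−1}(M ∖ e)` for `k ≥ 1`. -/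
theorem card_uniIndepSets_coloop {e : α} (he : e ∈ gr M) (hec : rk M ((gr M).erase e) + 1 = rk M (gr M))
    {k : ℕ} (hk : 1 ≤ k) :
    (uniIndepSets M k).card =
      (uniIndepSets (M ＼ ({e} : Set α)) k).card + (uniIndepSets (M ＼ ({e} : Set α)) (k - 1)).card := by
  rw [← card_filter_add_card_filter_not (s := uniIndepSets M k) (fun X => e ∉ X),
    filter_uniIndepSets_notMem_coloop he hec k, ← card_filter_uniIndepSets_mem_coloop he hec hk]
  congr 2
  ext X
  simp only [mem_filter, not_not]

/-- There is no unicyclic `0`-set. -/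
theorem uniIndepSets_zero_eq_empty : uniIndepSets M 0 = ∅ := by
  apply Finset.eq_empty_of_forall_notMem
  intro X hX
  rw [mem_uniIndepSets] at hX
  omega

/-- There is no unicyclic `k`-set for `k > #E`. -/
theorem uniIndepSets_eq_empty_of_card_lt {k : ℕ} (hk : (gr M).card < k) : uniIndepSets M k = ∅ := by
  apply Finset.eq_empty_of_forall_notMem
  intro X hX
  rw [mem_uniIndepSets] at hX
  have := card_le_card hX.1
  omega

/-- `S_0 = 0`. -/
theorem uniSymm_zero : uniSymm M 0 = 0 := by
  unfold uniSymm
  rw [uniIndepSets_zero_eq_empty, uniIndepSets_eq_empty_of_card_lt (by omega), card_empty]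

/-- **The symmetrised unicyclic count at a coloop**: `S_k(M) = S_k(M ∖ e) + S_{k−1}(M ∖ e)` for `1 ≤ k ≤ #E`. -/
theorem uniSymm_coloop {e : α} (he : e ∈ gr M) (hec : rk M ((gr M).erase e) + 1 = rk M (gr M)) {k : ℕ}
    (hk1 : 1 ≤ k) (hkn : k ≤ (gr M).card) :
    uniSymm M k = uniSymm (M ＼ ({e} : Set α)) k + uniSymm (M ＼ ({e} : Set α)) (k - 1) := by
  have hcard : (gr (M ＼ ({e} : Set α))).card = (gr M).card - 1 := by
    rw [gr_delete', card_erase_of_mem he]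
  unfold uniSymm
  rw [hcard, card_uniIndepSets_coloop he hec hk1, card_uniIndepSets_coloop he hec (k := (gr M).card + 1 - k) (by omega),
    show (gr M).card - 1 + 1 - k = (gr M).card + 1 - k - 1 by omega,
    show (gr M).card - 1 + 1 - (k - 1) = (gr M).card + 1 - k by omega]
  ring

/-! ### `RowAll` is closed under adding a coloop -/

/-- **THE `RowAll` INSTANCE OF `M` AT LEVEL `k` FROM THE INSTANCES OF `M ∖ e` AT LEVELS `k − 1` AND `k`**, for a coloop
`e` (the level-`(k − 1)` instance is needed for `k ≥ 2`, the level-`k` instance only inside its own window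
`2k + 1 ≤ n − 1`; at the boundary `2k + 1 = n` the symmetries of `M ∖ e` on `2k` elements replace it).  CONDITIONAL on
the named fact through `P_{k−1}(M ∖ e) ≤ P_k(M ∖ e)`; the splits are unconditional. -/
theorem rowAll_of_delete_coloop_of_fact (hfact : BiIndepDensityLogConcave α) (M : Matroid α) [M.Finite] {e : α}
    (he : e ∈ gr M) (hec : rk M ((gr M).erase e) + 1 = rk M (gr M)) (k : ℕ) (hk1 : 1 ≤ k)
    (hk : 2 * k + 1 ≤ (gr M).card)
    (h1 : 2 ≤ k →
      ((gr (M ＼ ({e} : Set α))).card - (k - 1)) *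
          ((biIndepSets (M ＼ ({e} : Set α)) (k - 1 - 1)).card + uniSymm (M ＼ ({e} : Set α)) (k - 1)) ≤
        (k - 1) * ((biIndepSets (M ＼ ({e} : Set α)) (k - 1 + 1)).card + uniSymm (M ＼ ({e} : Set α)) (k - 1 + 1)))
    (h2 : 2 * k + 1 ≤ (gr (M ＼ ({e} : Set α))).card →
      ((gr (M ＼ ({e} : Set α))).card - k) *
          ((biIndepSets (M ＼ ({e} : Set α)) (k - 1)).card + uniSymm (M ＼ ({e} : Set α)) k) ≤
        k * ((biIndepSets (M ＼ ({e} : Set α)) (k + 1)).card + uniSymm (M ＼ ({e} : Set α)) (k + 1))) :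
    ((gr M).card - k) * ((biIndepSets M (k - 1)).card + uniSymm M k) ≤
      k * ((biIndepSets M (k + 1)).card + uniSymm M (k + 1)) := by
  have hN : (gr (M ＼ ({e} : Set α))).card = (gr M).card - 1 := by
    rw [gr_delete', card_erase_of_mem he]
  obtain ⟨j, rfl⟩ : ∃ j, k = j + 1 := ⟨k - 1, by omega⟩
  have hmono := biIndepDensity_mono_of_fact hfact (M ＼ ({e} : Set α)) j (by rw [hN]; omega)
  rw [hN] at hmono h1 h2
  -- the splits
  rw [uniSymm_coloop he hec hk1 (by omega), uniSymm_coloop he hec (k := j + 1 + 1) (by omega) (by omega),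
    card_biIndepSets_coloop he hec (k := j + 1 + 1) (by omega), show j + 1 + 1 - 1 = j + 1 by omega,
    show j + 1 - 1 = j by omega]
  rcases Nat.eq_zero_or_pos j with rfl | hj1
  · -- level `k = 1`: `P_0(M) = P_0(M ∖ e)`, `S_0(M ∖ e) = 0`
    rw [card_biIndepSets_zero_coloop he hec, uniSymm_zero]
    obtain ⟨m, hm⟩ := Nat.exists_eq_add_of_le hk
    rw [hm] at h2 hmono ⊢
    rw [show 2 * (0 + 1) + 1 + m - (0 + 1) = m + 2 by omega]
    rw [show 2 * (0 + 1) + 1 + m - 1 - 0 = m + 2 by omega] at hmono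
    rcases Nat.eq_zero_or_pos m with rfl | hm1
    · -- the boundary `n = 3`: `M ∖ e` has `2` elements
      have hs := card_biIndepSets_symm (M ＼ ({e} : Set α)) (k := 0 + 1 + 1) (by rw [hN, hm])
      rw [hN, hm, show 2 * (0 + 1) + 1 + 0 - 1 - (0 + 1 + 1) = 0 by omega] at hs
      have hu : uniSymm (M ＼ ({e} : Set α)) (0 + 1 + 1) = uniSymm (M ＼ ({e} : Set α)) (0 + 1) := by
        unfold uniSymm
        rw [hN, hm, show 2 * (0 + 1) + 1 + 0 - 1 + 1 - (0 + 1 + 1) = 0 + 1 by omega,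
          show 2 * (0 + 1) + 1 + 0 - 1 + 1 - (0 + 1) = 0 + 1 + 1 by omega]
        ring
      rw [hs, hu]
      nlinarith [hmono]
    · have h2' := h2 (by omega)
      rw [show 2 * (0 + 1) + 1 + m - 1 - (0 + 1) = m + 1 by omega] at h2'
      nlinarith [h2', hmono]
  · have h1' := h1 (by omega)
    rw [show j + 1 - 1 = j by omega] at h1'
    rw [card_biIndepSets_coloop he hec hj1]
    obtain ⟨m, hm⟩ := Nat.exists_eq_add_of_le hk
    rw [hm] at h1' h2 hmono ⊢
    rw [show 2 * (j + 1) + 1 + m - (j + 1) = j + 2 + m by omega]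
    rw [show 2 * (j + 1) + 1 + m - 1 - j = j + 2 + m by omega] at h1' hmono
    rcases Nat.eq_zero_or_pos m with rfl | hm1
    · -- the boundary `2k + 1 = n`: `M ∖ e` has `2k` elements, `P_{k+1} = P_{k−1}` and `S_{k+1} = S_k` there
      have hs := card_biIndepSets_symm (M ＼ ({e} : Set α)) (k := j + 1 + 1) (by rw [hN, hm]; omega)
      rw [hN, hm, show 2 * (j + 1) + 1 + 0 - 1 - (j + 1 + 1) = j by omega] at hs
      have hu : uniSymm (M ＼ ({e} : Set α)) (j + 1 + 1) = uniSymm (M ＼ ({e} : Set α)) (j + 1) := by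
        unfold uniSymm
        rw [hN, hm, show 2 * (j + 1) + 1 + 0 - 1 + 1 - (j + 1 + 1) = j + 1 by omega,
          show 2 * (j + 1) + 1 + 0 - 1 + 1 - (j + 1) = j + 1 + 1 by omega]
        ring
      rw [hs, hu]
      generalize (biIndepSets (M ＼ ({e} : Set α)) (j - 1)).card = Q0 at h1' ⊢
      generalize (biIndepSets (M ＼ ({e} : Set α)) j).card = Q1 at h1' hmono ⊢
      generalize (biIndepSets (M ＼ ({e} : Set α)) (j + 1)).card = Q2 at h1' hmono ⊢
      generalize uniSymm (M ＼ ({e} : Set α)) j = S0 at h1' ⊢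
      generalize uniSymm (M ＼ ({e} : Set α)) (j + 1) = S1 at h1' ⊢
      nlinarith [h1', hmono]
    · have h2' := h2 (by omega)
      rw [show 2 * (j + 1) + 1 + m - 1 - (j + 1) = j + 1 + m by omega, show j + 1 - 1 = j by omega] at h2'
      generalize (biIndepSets (M ＼ ({e} : Set α)) (j - 1)).card = Q0 at h1' ⊢
      generalize (biIndepSets (M ＼ ({e} : Set α)) j).card = Q1 at h1' h2' hmono ⊢
      generalize (biIndepSets (M ＼ ({e} : Set α)) (j + 1)).card = Q2 at h1' hmono ⊢
      generalize (biIndepSets (M ＼ ({e} : Set α)) (j + 1 + 1)).card = Q3 at h2' ⊢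
      generalize uniSymm (M ＼ ({e} : Set α)) j = S0 at h1' ⊢
      generalize uniSymm (M ＼ ({e} : Set α)) (j + 1) = S1 at h1' h2' ⊢
      generalize uniSymm (M ＼ ({e} : Set α)) (j + 1 + 1) = S2 at h2' ⊢
      nlinarith [h1', h2', hmono]

/-- `RowAll` at every level of one matroid, as a predicate (the body of `RowAll` at `M`). -/
def RowAllAt (M : Matroid α) [M.Finite] : Prop :=
  ∀ k : ℕ, 1 ≤ k → 2 * k + 1 ≤ (gr M).card →
    ((gr M).card - k) * ((biIndepSets M (k - 1)).card + uniSymm M k) ≤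
      k * ((biIndepSets M (k + 1)).card + uniSymm M (k + 1))

/-- `RowAll α` is exactly `RowAllAt` at every finite matroid on `α`. -/
theorem rowAll_iff_forall_rowAllAt : RowAll α ↔ ∀ (M : Matroid α) [M.Finite], RowAllAt M := by
  constructor
  · intro h M _ k hk1 hk
    exact h M k hk1 hk
  · intro h M _ k hk1 hk
    exact h M k hk1 hk

/-- **`RowAll` IS CLOSED UNDER ADDING A COLOOP** (CONDITIONAL on the named fact): for a coloop `e` of `M`, `RowAll` at
every level of `M ∖ e` gives `RowAll` at every level of `M`. -/
theorem rowAllAt_of_delete_coloop_of_fact (hfact : BiIndepDensityLogConcave α) (M : Matroid α) [M.Finite] {e : α}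
    (he : e ∈ gr M) (hec : rk M ((gr M).erase e) + 1 = rk M (gr M))
    (h : RowAllAt (M ＼ ({e} : Set α))) : RowAllAt M := by
  intro k hk1 hk
  refine rowAll_of_delete_coloop_of_fact hfact M he hec k hk1 hk (fun hk2 => h (k - 1) (by omega) ?_)
    (fun hk2 => h k hk1 hk2)
  rw [gr_delete', card_erase_of_mem he]
  omega

/-- **MINIMAL `RowAll`-WITNESSES ARE COLOOP-FREE** (CONDITIONAL on the named fact): a failure of `RowAll` at `M` with a
coloop `e` is already a failure at `M ∖ e`. -/
theorem not_rowAllAt_delete_coloop_of_fact (hfact : BiIndepDensityLogConcave α) (M : Matroid α) [M.Finite] {e : α}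
    (he : e ∈ gr M) (hec : rk M ((gr M).erase e) + 1 = rk M (gr M)) (h : ¬ RowAllAt M) :
    ¬ RowAllAt (M ＼ ({e} : Set α)) :=
  fun h' => h (rowAllAt_of_delete_coloop_of_fact hfact M he hec h')

end PercRepro.Cogirth
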